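import Mathlib
import HarnessLib
import Summits.HubbardSuperconductivity.HubbardSuperconductivity.Theorems.KLProgrammeH10TwoPointLimitSectorMultiplierL1
import Summits.HubbardSuperconductivity.HubbardSuperconductivity.Theorems.KLProgrammeKLRegimeTorusL1SecondDifferences
import Summits.HubbardSuperconductivity.HubbardSuperconductivity.Theorems.KLProgrammeKLRegimeSectorMultiplierFrameDiffs

/-!
# Route `KLProgramme` — VL child `KLRegimeVolumeLimitV17F2` (stmt-HubbardSuperconductivity-20440), closer MODEL file M2 «MISMATCH-SLICE», bracket (c),
# part 2e-ii: the `ℓ¹` SIZE of the space-time character sum of the thin-pair DIFFERENCE on two frames — `Σ_z ‖S^Δ(z)‖ ≤ √W·√(16·2M·L²·N_s^Δ)·A^Δ(ε)`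
# with `A^Δ(ε)` LINEAR in the frame increment `ε`

Cell `gate-hubbard-kl`, seat hubbard-kl-k3c4-p2 (g11; UV / Matsubara all-U lane), ask «MISMATCH-SLICE» (= M2, bracket (c)) of the VL registrant
k3c4-p1 g11.  Composition of part 2e-i (`…SectorMultiplierFrameDiffs`: sup `S(ε)`, support count, time second differences `T(ε)`, second
differences `‖w‖²·Ξ(ε)` along any integer step) with k3c2-p3's master lemma `sum_norm_charSum_le_of_second_differences` in the UNIT-STEP form
(`v = (1,0)`, `v⊥ = (0,1)`, axes, `R₀ = 0`; free rates `s₀, s₁ > 0`):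

* §1 **`sum_norm_charSum_le_of_unitSteps`** (generic, any torus `(ℤ/P) × (ℤ/L)²`): if `‖G‖ ≤ S`, `#{G ≠ 0} ≤ N_s`, `‖Δ²_{(1,0)}G‖ ≤ T` and
  `‖Δ²_{(0,u)}G‖ ≤ X` for every integer step with `|u_j| ≤ 1`, then
  `Σ_z ‖S(z)‖ ≤ √(2048(1/s₀+1)(4(2√2/s₁+2)² + 16(1/s₁+1)²))·√(16PL²N_s)·(S + T/(4/(s₀P))² + X/(4/(s₁L))²)` — the amplitude is a SUM, so no
  rate inequality has to be checked (cf. `…SectorSliceDefectPairFat`);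
* §2 **`sum_norm_charSum_thinPairDiff_le`** — the model instance for `D = F[K′]F[K′] − F[K]F[K]` (thin pair `n₂ ≤ n₁`, frames of common `C²` size
  `A`, `4π ≤ zL`, window `Λ_{n₁}β < π(2M−3)`): `S = g₁/Λ²·(2E₀ε·1)`, `T = (4h₂+2h₁)(2π/β)²(2E₀ε·1)/Λ²`, `X = (2π/L)²·Ξ(ε)`,
  `N_s^Δ = 2 ×` p4's pair count — every term of the amplitude carries `ε ≥ max_j coeffNorm j (K′ ⊖ K)` (`= Σ_i c_i(n⋆)/L` on the two top frames).

The plain / pinned position sums of the overlap-kernel defect then follow from `…SectorOverlapDefectRows.rowSum_overlapKernel_sub_eq` /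
`colSum_overlapKernel_sub_eq` (`(βL²)⁻¹ Σ_z ‖S^Δ(z)‖`), the thin × fat pair being a sum of `≤ 3` thin pairs at each frame
(`klAnisoFamily_mul_bgmFatMultiplier_eq_sum`).  Everything is proved; no definitions, no named facts. [folklore]
References: BGM 2006 §2.6 (2.81) footnote 1, §2.7 (2.71a), §3 (3.3).
-/

noncomputable section

namespace Summit.HubbardSuperconductivity.HubbardSuperconductivity.Theorems.TorusFourierL2

set_option linter.dupNamespace false -- summit = problem name (single-conjunct summit), D-0017

open Set Finset Literature.MathematicalPhysics.QuantumLattice Literature.MathematicalPhysics.QuantumLattice.BandSectorCounting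
open Literature.MathematicalPhysics.QuantumLattice.FermiRG Literature.Probability.LatticeModels Literature.Analysis.SpecialFunctions
open Summit.HubbardSuperconductivity.HubbardSuperconductivity.Theorems.DispersionFlow
open Summit.HubbardSuperconductivity.HubbardSuperconductivity.Theorems.KLRegimeSplit
open Summit.HubbardSuperconductivity.HubbardSuperconductivity.Theorems.KLProgrammeLegKernels
open Summit.HubbardSuperconductivity.HubbardSuperconductivity.Theorems.PerturbedFermiCurve
open scoped Real

/-! ## §1 The master lemma in unit-step form with a summed amplitude -/

/-- **`ℓ¹` of a space-time character sum from the sup, the support count, the time second differences and the second differences along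
UNIT integer steps**, free rates `s₀, s₁ > 0`, amplitude `S + T/(4/(s₀P))² + X/(4/(s₁L))²` (a sum — each of the master lemma's four
inequalities holds term by term). [cite: BenfattoGiulianiMastropietro2006, §2.6 (2.81) and footnote 1] -/
theorem sum_norm_charSum_le_of_unitSteps {P L : ℕ} [NeZero P] [NeZero L] (G : TorusSite 1 P × TorusSite 2 L → ℂ)
    {S T X : ℝ} (hS : 0 ≤ S) (hT : 0 ≤ T) (hX : 0 ≤ X) {Ns : ℕ}
    (hsupp : (univ.filter fun q => G q ≠ 0).card ≤ Ns) (hsup : ∀ q, ‖G q‖ ≤ S)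
    (h₀ : ∀ q, ‖(fwdDiff ((fun _ : Fin 1 => (1 : ZMod P)), (0 : TorusSite 2 L)))^[2] G q‖ ≤ T)
    (h₁ : ∀ u : Fin 2 → ℤ, (∀ j, |u j| ≤ 1) → ∀ q, ‖(fwdDiff ((0 : TorusSite 1 P), (fun j => ((u j : ℤ) : ZMod L))))^[2] G q‖ ≤ X)
    {s₀ s₁ : ℝ} (hs₀ : 0 < s₀) (hs₁ : 0 < s₁) :
    ∑ z : TorusSite 1 P × TorusSite 2 L, ‖∑ q : TorusSite 1 P × TorusSite 2 L, (torusChar q.1 z.1 * torusChar q.2 z.2) • G q‖ ≤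
      Real.sqrt (2048 * (1 / s₀ + 1) * (4 * ((2 * Real.sqrt 2 / s₁ + 2) * (2 * Real.sqrt 2 / s₁ + 2)) + 16 * (1 / s₁ + 1) ^ 2)) *
        Real.sqrt (16 * P * (L : ℝ) ^ 2 * Ns) * (S + T / (4 / (s₀ * P)) ^ 2 + X / (4 / (s₁ * L)) ^ 2) := by
  have hP : (0 : ℝ) < P := Nat.cast_pos.2 (Nat.pos_of_ne_zero (NeZero.ne P))
  have hL : (0 : ℝ) < L := Nat.cast_pos.2 (Nat.pos_of_ne_zero (NeZero.ne L))
  have hc₀ : 0 < (4 / (s₀ * P)) ^ 2 := by positivity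
  have hc₁ : 0 < (4 / (s₁ * L)) ^ 2 := by positivity
  set A₀ : ℝ := S + T / (4 / (s₀ * P)) ^ 2 + X / (4 / (s₁ * L)) ^ 2 with hA₀
  have hT' : 0 ≤ T / (4 / (s₀ * P)) ^ 2 := by positivity
  have hX' : 0 ≤ X / (4 / (s₁ * L)) ^ 2 := by positivity
  have hA₀0 : 0 ≤ A₀ := by positivity
  have hSA : S ≤ A₀ := by rw [hA₀]; linarith
  have hTA : T ≤ A₀ * (4 / (s₀ * P)) ^ 2 := by
    have : T = T / (4 / (s₀ * P)) ^ 2 * (4 / (s₀ * P)) ^ 2 := by field_simp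
    rw [this]; gcongr; rw [hA₀]; linarith
  have hXA : X ≤ A₀ * (4 / (s₁ * L)) ^ 2 := by
    have : X = X / (4 / (s₁ * L)) ^ 2 * (4 / (s₁ * L)) ^ 2 := by field_simp
    rw [this]; gcongr; rw [hA₀]; linarith
  -- the step `v = (1, 0)`, `R₀ = 0`
  have hv : (![1, 0] : Fin 2 → ℤ) ≠ 0 := by
    intro h; have := congr_fun h 0; simp at this
  have hR₀ : 2 * (|(![1, 0] : Fin 2 → ℤ) 0| + |(![1, 0] : Fin 2 → ℤ) 1|) * ((0 : ℕ) : ℤ) < L := by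
    simp only [Nat.cast_zero, mul_zero]
    exact_mod_cast Nat.pos_of_ne_zero (NeZero.ne L)
  have hunit_v : ∀ j, |(![1, 0] : Fin 2 → ℤ) j| ≤ 1 := by intro j; fin_cases j <;> simp
  have hunit_p : ∀ j, |(![-(![1, 0] : Fin 2 → ℤ) 1, (![1, 0] : Fin 2 → ℤ) 0] : Fin 2 → ℤ) j| ≤ 1 := by
    intro j; fin_cases j <;> simp
  have hunit_e : ∀ (i j : Fin 2), |(Pi.single i (1 : ℤ) : Fin 2 → ℤ) j| ≤ 1 := by
    intro i j; by_cases h : j = i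
    · subst h; simp
    · simp [h]
  have main := sum_norm_charSum_le_of_second_differences G (![1, 0]) hv hs₀ hs₁ hs₁ hs₁ (R₀ := 0) hR₀ hA₀0 hsupp
    (fun q => (hsup q).trans hSA) (fun q => (h₀ q).trans hTA)
    (fun q i => by
      rw [← axisStep_cast L i]
      exact (h₁ _ (hunit_e i) q).trans hXA)
    (fun q => (h₁ _ hunit_p q).trans hXA) (fun q => (h₁ _ hunit_v q).trans hXA)
  have hnorm : Real.sqrt ((((![1, 0] : Fin 2 → ℤ) 0 : ℤ) : ℝ) ^ 2 + (((![1, 0] : Fin 2 → ℤ) 1 : ℤ) : ℝ) ^ 2) = 1 := by simp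
  rw [hnorm, mul_one] at main
  simpa only [Nat.cast_zero, mul_zero, add_zero, div_one] using main

/-! ## §2 The model instance: the thin-pair difference on two frames -/

section ThinPairDiff

variable {L M : ℕ} [NeZero L] [NeZero M] {a b : ℝ} (B : BandBounds a b) {K K' : TrigPolyC4v} {A : ℝ}
  (hA : ∀ p : Momentum, ∀ j ≤ 2, ‖iteratedFDeriv ℝ j (frameShift K) p‖ ≤ A)
  (hA' : ∀ p : Momentum, ∀ j ≤ 2, ‖iteratedFDeriv ℝ j (frameShift K') p‖ ≤ A) (hADt : 2 * A < B.Dtmin)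
  {μ e₀ z β : ℝ} (he : 0 < e₀) (hz : 0 < z) (hz1 : z ≤ 1) (hgap : e₀ + A + z ^ 2 < -μ) (h3 : e₀ + A - μ ≤ 3)
  (hlo : a ≤ μ - A - e₀) (hhi : μ + A + e₀ ≤ b) (hβ : 0 < β) (hρA : 4 * A < 2 * B.rhomin)
  {n₁ n₂ : ℕ} (hn : n₂ ≤ n₁) (ω₁ : Fin (sectorCount n₁)) (ω₂ : Fin (sectorCount n₂))
  {d : ℝ} (hd : 0 ≤ d) (hd1 : ∀ u, |deriv (bgmCutoffSq e₀) u| ≤ d) (hd2 : ∀ u, |iteratedDeriv 2 (bgmCutoffSq e₀) u| ≤ d)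
  (hd3 : ∀ u, |iteratedDeriv 3 (bgmCutoffSq e₀) u| ≤ d)
  {Z : (Fin 2 → ℝ) → ℝ}
  (hZ : ∀ p, Z p = gnCutoff ((π + z) ^ 2 / π ^ 2) ((π + z) ^ 2) (p 0 ^ 2) * gnCutoff ((π + z) ^ 2 / π ^ 2) ((π + z) ^ 2) (p 1 ^ 2) *
    ((radialCutoffC (1 / 2) (momToComplex p) * sectorWeightCirc n₁ ((ω₁ : ℕ) : ℤ) (polarAngle p)) *
      (radialCutoffC (1 / 2) (momToComplex p) * sectorWeightCirc n₂ ((ω₂ : ℕ) : ℤ) (polarAngle p))))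
  {z₁ z₂ : ℝ} (hZ1 : ∀ p, ‖fderiv ℝ Z p‖ ≤ z₁) (hZ2 : ∀ p, ‖iteratedFDeriv ℝ 2 Z p‖ ≤ z₂)
  {ε : ℝ} (hε : ∀ j ≤ 2, (fsub K' K).coeffNorm j ≤ ε)
  {Ds : TorusSite 1 (2 * M) × TorusSite 2 L → ℂ}
  (hDs : ∀ q, Ds q = klAnisoFamily L M β μ K' e₀ n₁ ω₁ (⟨(q.1 0).val, ZMod.val_lt (q.1 0)⟩, q.2) *
      klAnisoFamily L M β μ K' e₀ n₂ ω₂ (⟨(q.1 0).val, ZMod.val_lt (q.1 0)⟩, q.2) -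
    klAnisoFamily L M β μ K e₀ n₁ ω₁ (⟨(q.1 0).val, ZMod.val_lt (q.1 0)⟩, q.2) *
      klAnisoFamily L M β μ K e₀ n₂ ω₂ (⟨(q.1 0).val, ZMod.val_lt (q.1 0)⟩, q.2))
set_option maxHeartbeats 400000 in
include B hA hA' hADt he hz hz1 hgap h3 hlo hhi hβ hρA hn hd hd1 hd2 hd3 hZ hZ1 hZ2 hε hDs in
/-- **`ℓ¹` SIZE OF THE CHARACTER SUM OF THE THIN-PAIR DIFFERENCE ON TWO FRAMES.**  With `Λ = Λ_{n₁}`, `E₀ = 4+A+|μ|`, `K₁ = 4+2A`, `K₂ = 4+4A`, the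
product-profile constants `g₁, g₂, g₃` (`scaleProfile_mul_bounds₃`), `S = g₁/Λ²·(2E₀ε·1)`, `T = (4g₃/Λ²+2g₂/Λ²)(2π/β)²(2E₀ε·1)/Λ²`,
`X = (2π/L)²·Ξ(ε)` (`norm_fwdDiff_two_space_thinPairDiff_le`), `N_s^Δ = 2 ×` p4's pair count, and any rates `s₀, s₁ > 0`:
`Σ_z ‖Σ_q χ • D(q)‖ ≤ √W(s₀,s₁)·√(16·2M·L²·N_s^Δ)·(S + T/(4/(s₀·2M))² + X/(4/(s₁L))²)` — LINEAR in `ε`.  Hypotheses: `4π ≤ zL`, `Λβ < π(2M−3)`.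
[cite: BenfattoGiulianiMastropietro2006, §2.6 (2.81), §2.7 (2.71a), §3 (3.3)] -/
theorem sum_norm_charSum_thinPairDiff_le (hM : klScale e₀ n₁ * β < π * (2 * M - 3)) (hzL : 2 * |2 * π / (L : ℝ)| ≤ z)
    {s₀ s₁ : ℝ} (hs₀ : 0 < s₀) (hs₁ : 0 < s₁) :
    ∑ w : TorusSite 1 (2 * M) × TorusSite 2 L, ‖∑ q : TorusSite 1 (2 * M) × TorusSite 2 L, (torusChar q.1 w.1 * torusChar q.2 w.2) • Ds q‖ ≤
      Real.sqrt (2048 * (1 / s₀ + 1) * (4 * ((2 * Real.sqrt 2 / s₁ + 2) * (2 * Real.sqrt 2 / s₁ + 2)) + 16 * (1 / s₁ + 1) ^ 2)) *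
        Real.sqrt (16 * ((2 * M : ℕ) : ℝ) * (L : ℝ) ^ 2 *
          (2 * ((klScale e₀ n₁ * β / π + 1) *
            ((Real.sqrt 2 * L * ((klScale e₀ n₁ + (4 + 4 * A) *
                ((klScale e₀ n₁ + B.smax * B.Dtmin * (3 * sectorWidth n₂ / 4)) / (B.Dtmin - 2 * A)) ^ 2) / (2 * B.rhomin - 4 * A)) / π + 2) *
              (Real.sqrt 2 * L * (2 * ((klScale e₀ n₁ + B.smax * B.Dtmin * (3 * sectorWidth n₂ / 4)) / (B.Dtmin - 2 * A))) / π + 2))))) *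
        ((d * e₀ ^ 2 * 1 + 1 * (d * e₀ ^ 2)) / klScale e₀ n₁ ^ 2 * (2 * (4 + A + |μ|) * ε * 1) +
          (4 * ((d * e₀ ^ 6 * 1 + 3 * (d * e₀ ^ 4) * (d * e₀ ^ 2) + 3 * (d * e₀ ^ 2) * (d * e₀ ^ 4) + 1 * (d * e₀ ^ 6)) / klScale e₀ n₁ ^ 2) +
              2 * ((d * e₀ ^ 4 * 1 + 2 * (d * e₀ ^ 2) * (d * e₀ ^ 2) + 1 * (d * e₀ ^ 4)) / klScale e₀ n₁ ^ 2)) *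
            (2 * π / β) ^ 2 * (2 * (4 + A + |μ|) * ε * 1) / klScale e₀ n₁ ^ 2 / (4 / (s₀ * ((2 * M : ℕ) : ℝ))) ^ 2 +
          (2 * π / L) ^ 2 *
            (((4 * ((d * e₀ ^ 6 * 1 + 3 * (d * e₀ ^ 4) * (d * e₀ ^ 2) + 3 * (d * e₀ ^ 2) * (d * e₀ ^ 4) + 1 * (d * e₀ ^ 6)) /
                    klScale e₀ n₁ ^ 2) +
                  2 * ((d * e₀ ^ 4 * 1 + 2 * (d * e₀ ^ 2) * (d * e₀ ^ 2) + 1 * (d * e₀ ^ 4)) / klScale e₀ n₁ ^ 2)) *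
                  (4 + 2 * A) ^ 2 / klScale e₀ n₁ ^ 2 +
                2 * ((d * e₀ ^ 4 * 1 + 2 * (d * e₀ ^ 2) * (d * e₀ ^ 2) + 1 * (d * e₀ ^ 4)) / klScale e₀ n₁ ^ 2) * (4 + 4 * A) /
                  klScale e₀ n₁) * (2 * (4 + A + |μ|) * ε * 1) +
              4 * ((d * e₀ ^ 4 * 1 + 2 * (d * e₀ ^ 2) * (d * e₀ ^ 2) + 1 * (d * e₀ ^ 4)) / klScale e₀ n₁ ^ 2) * (4 + 2 * A) /
                  klScale e₀ n₁ * (2 * (((4 + 2 * A) * ε + (4 + A + |μ|) * (2 * ε)) * 1 + (4 + A + |μ|) * ε * z₁)) +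
              (d * e₀ ^ 2 * 1 + 1 * (d * e₀ ^ 2)) / klScale e₀ n₁ ^ 2 *
                (2 * (((4 + 4 * A) * ε + 2 * (4 + 2 * A) * (2 * ε) + (4 + A + |μ|) * (4 * ε)) * 1 +
                  2 * ((4 + 2 * A) * ε + (4 + A + |μ|) * (2 * ε)) * z₁ + (4 + A + |μ|) * ε * z₂))) /
            (4 / (s₁ * L)) ^ 2) := by
  haveI : NeZero (2 * M) := ⟨by have := NeZero.ne M; omega⟩
  have hL : (0 : ℝ) < L := Nat.cast_pos.2 (Nat.pos_of_ne_zero (NeZero.ne L))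
  have hΛ : 0 < klScale e₀ n₁ := by rw [klScale]; positivity
  have hA0 : 0 ≤ A := le_trans (norm_nonneg _) (hA 0 0 (by norm_num))
  have hε0 : 0 ≤ ε := le_trans (TrigPolyC4v.coeffNorm_nonneg 0 _) (hε 0 (by norm_num))
  have hz₁ : 0 ≤ z₁ := le_trans (norm_nonneg _) (hZ1 0)
  have hz₂ : 0 ≤ z₂ := le_trans (norm_nonneg _) (hZ2 0)
  -- the four inputs of part 2e-i
  have hsup := norm_thinPairDiff_le hA hA' he hz h3 hn ω₁ ω₂ hd hd1 hd2 hd3 hZ hε hDs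
  have hNs := card_support_thinPairDiff_le B hA hA' hADt he hz hz1 hgap h3 hlo hhi hβ hρA hn ω₁ ω₂ hd hd1 hd2 hZ hDs
  have h0 := norm_fwdDiff_two_time_thinPairDiff_le hA hA' he hz h3 hβ hn ω₁ ω₂ hd hd1 hd2 hd3 hZ hε hDs hM
  have hsp := norm_fwdDiff_two_space_thinPairDiff_le hA hA' he hz hz1 hgap h3 hn ω₁ ω₂ hd hd1 hd2 hd3 hZ hZ1 hZ2 hε hDs
  -- abbreviate the step-free constant `Ξ`
  set Ξ : ℝ := ((4 * ((d * e₀ ^ 6 * 1 + 3 * (d * e₀ ^ 4) * (d * e₀ ^ 2) + 3 * (d * e₀ ^ 2) * (d * e₀ ^ 4) + 1 * (d * e₀ ^ 6)) /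
                    klScale e₀ n₁ ^ 2) +
                  2 * ((d * e₀ ^ 4 * 1 + 2 * (d * e₀ ^ 2) * (d * e₀ ^ 2) + 1 * (d * e₀ ^ 4)) / klScale e₀ n₁ ^ 2)) *
                  (4 + 2 * A) ^ 2 / klScale e₀ n₁ ^ 2 +
                2 * ((d * e₀ ^ 4 * 1 + 2 * (d * e₀ ^ 2) * (d * e₀ ^ 2) + 1 * (d * e₀ ^ 4)) / klScale e₀ n₁ ^ 2) * (4 + 4 * A) /
                  klScale e₀ n₁) * (2 * (4 + A + |μ|) * ε * 1) +
              4 * ((d * e₀ ^ 4 * 1 + 2 * (d * e₀ ^ 2) * (d * e₀ ^ 2) + 1 * (d * e₀ ^ 4)) / klScale e₀ n₁ ^ 2) * (4 + 2 * A) /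
                  klScale e₀ n₁ * (2 * (((4 + 2 * A) * ε + (4 + A + |μ|) * (2 * ε)) * 1 + (4 + A + |μ|) * ε * z₁)) +
              (d * e₀ ^ 2 * 1 + 1 * (d * e₀ ^ 2)) / klScale e₀ n₁ ^ 2 *
                (2 * (((4 + 4 * A) * ε + 2 * (4 + 2 * A) * (2 * ε) + (4 + A + |μ|) * (4 * ε)) * 1 +
                  2 * ((4 + 2 * A) * ε + (4 + A + |μ|) * (2 * ε)) * z₁ + (4 + A + |μ|) * ε * z₂)) with hΞ
  have hΞ0 : 0 ≤ Ξ := by rw [hΞ]; positivity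
  clear_value Ξ
  -- unit steps: `‖(2π/L)u‖ ≤ 2π/L` and the step condition `4π|u_j| ≤ zL`
  have h1 : ∀ u : Fin 2 → ℤ, (∀ j, |u j| ≤ 1) → ∀ q,
      ‖((fwdDiff ((0 : TorusSite 1 (2 * M)), (fun j => ((u j : ℤ) : ZMod L))))^[2] Ds) q‖ ≤ (2 * π / L) ^ 2 * Ξ := by
    intro u hu1 q
    have hu1' : ∀ j, |(u j : ℝ)| ≤ 1 := fun j => by exact_mod_cast hu1 j
    have hu : ∀ j, 2 * |2 * π / (L : ℝ)| * |(u j : ℝ)| ≤ z := fun j =>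
      (mul_le_of_le_one_right (by positivity) (hu1' j)).trans hzL
    have hw : ‖(fun j => 2 * π / L * (u j : ℝ))‖ ≤ 2 * π / L := by
      refine (pi_norm_le_iff_of_nonneg (by positivity)).2 fun j => ?_
      rw [Real.norm_eq_abs, abs_mul, abs_of_pos (by positivity : (0 : ℝ) < 2 * π / L)]
      exact mul_le_of_le_one_right (by positivity) (hu1' j)
    refine (hsp u hu q).trans ?_
    exact mul_le_mul_of_nonneg_right (pow_le_pow_left₀ (norm_nonneg _) hw 2) hΞ0
  have hS0 : 0 ≤ (d * e₀ ^ 2 * 1 + 1 * (d * e₀ ^ 2)) / klScale e₀ n₁ ^ 2 * (2 * (4 + A + |μ|) * ε * 1) := by positivity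
  have hT0 : 0 ≤ (4 * ((d * e₀ ^ 6 * 1 + 3 * (d * e₀ ^ 4) * (d * e₀ ^ 2) + 3 * (d * e₀ ^ 2) * (d * e₀ ^ 4) + 1 * (d * e₀ ^ 6)) /
          klScale e₀ n₁ ^ 2) + 2 * ((d * e₀ ^ 4 * 1 + 2 * (d * e₀ ^ 2) * (d * e₀ ^ 2) + 1 * (d * e₀ ^ 4)) / klScale e₀ n₁ ^ 2)) *
        (2 * π / β) ^ 2 * (2 * (4 + A + |μ|) * ε * 1) / klScale e₀ n₁ ^ 2 := by positivity
  have hX0 : 0 ≤ (2 * π / L) ^ 2 * Ξ := mul_nonneg (by positivity) hΞ0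
  have main := sum_norm_charSum_le_of_unitSteps (P := 2 * M) Ds hS0 hT0 hX0
    (Ns := (univ.filter fun q : TorusSite 1 (2 * M) × TorusSite 2 L => Ds q ≠ 0).card) le_rfl hsup h0 h1 hs₀ hs₁
  refine main.trans ?_
  have hamp : 0 ≤ (d * e₀ ^ 2 * 1 + 1 * (d * e₀ ^ 2)) / klScale e₀ n₁ ^ 2 * (2 * (4 + A + |μ|) * ε * 1) +
      (4 * ((d * e₀ ^ 6 * 1 + 3 * (d * e₀ ^ 4) * (d * e₀ ^ 2) + 3 * (d * e₀ ^ 2) * (d * e₀ ^ 4) + 1 * (d * e₀ ^ 6)) / klScale e₀ n₁ ^ 2) +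
          2 * ((d * e₀ ^ 4 * 1 + 2 * (d * e₀ ^ 2) * (d * e₀ ^ 2) + 1 * (d * e₀ ^ 4)) / klScale e₀ n₁ ^ 2)) *
        (2 * π / β) ^ 2 * (2 * (4 + A + |μ|) * ε * 1) / klScale e₀ n₁ ^ 2 / (4 / (s₀ * ((2 * M : ℕ) : ℝ))) ^ 2 +
      (2 * π / L) ^ 2 * Ξ / (4 / (s₁ * L)) ^ 2 :=
    add_nonneg (add_nonneg hS0 (div_nonneg hT0 (by positivity))) (div_nonneg hX0 (by positivity))
  gcongr

end ThinPairDiff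

end Summit.HubbardSuperconductivity.HubbardSuperconductivity.Theorems.TorusFourierL2

end
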